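import Literature.AlgebraicGeometry.Resolution.AlterationsGraphClosure
import Literature.AlgebraicGeometry.Resolution.AlterationsPurelyInseparable
import Literature.AlgebraicGeometry.Resolution.AlterationsResolution
import HarnessLib

/-!
# `Pialt` (crux stmt-ResolutionOfSingularities-0555), line `SketchIdeator2`, Card B: `Pialt ⇒ FrobIndet`

Stub `stub_frobIndet_of_pialtOver` of the lead's skeleton `indeterminacy-split` (helper file,
`--supports stmt-ResolutionOfSingularities-0555`; does not close the item).

**Statement.** Fix a field `k` and assume the crux conclusion for EVERY integral separated
`k`-scheme of finite type `X'` (a proper `g : X'' → X'` from an integral regular `X''`,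
surjective, finite and radicial over a dense open). Then purely inseparable ELIMINATION OF
INDETERMINACY holds over `k`: for `Y`, `X₁` proper integral over `k` (with `Y` regular — not
used) and a rational map given by a `k`-morphism `φ : V → X₁` on a non-empty open `V ⊆ Y`, there
are a proper surjective `g : Y' → Y` from an integral regular `Y'`, finite and radicial over a
dense open of `Y`, and a `k`-morphism `ψ : Y' → X₁` with `ψ = φ ∘ g` on `g⁻¹(V)`.

**Proof** (de Jong 1996, 4.18–4.19: the closure of the graph). Let `T ⊆ Y ×_k X₁` be the
closure of the graph `Γ_φ = (ι, φ) : V → Y ×_k X₁` (`DeJong1996.graphClosure`, over the base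
`Y` with `p = 𝟙 Y`, `f = pr_Y : Y ×_k X₁ → Y`, `U = V` and `β` the corestriction of `Γ_φ` to
`pr_Y⁻¹(V)`), with projections `pr₁ : T → Y`, `pr₂ : T → Y ×_k X₁`. Then `T` is integral
(`DeJong1996.isIntegral_graphClosure`), `pr₁` is proper (base change of the proper `X₁ → k`)
and birational (`DeJong1996.isBirational_graphClosureFst`), and over `V` it is an isomorphism
whose inverse is the corestriction of `V → T`; consequently
`(pr₁⁻¹V ↪ T) ≫ pr₂ = pr₁|_V ≫ Γ_φ` (`ι_comp_graphClosureSnd`). Apply the hypothesis to the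
integral separated finite type `k`-scheme `T`: `g'' : Y'' → T`. Put `Y' = Y''`,
`g = g'' ≫ pr₁`, `ψ = g'' ≫ pr₂ ≫ pr_{X₁}`. Then `g` is a composition of purely inseparable
alterations (`IsBirational.isPurelyInseparableAlteration`, `IsPurelyInseparableAlteration.comp`),
hence proper, surjective and finite radicial over a dense open; `ψ` is a `k`-morphism; and on
`g⁻¹(V) = g''⁻¹(pr₁⁻¹ V)` the displayed identity gives `ψ = φ ∘ g`.
-/

set_option linter.dupNamespace false -- mandated namespace of this single-conjunct summit

noncomputable section

open CategoryTheory CategoryTheory.Limits AlgebraicGeometry TopologicalSpace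
open Literature.AlgebraicGeometry.Resolution
open Literature.AlgebraicGeometry.Resolution.DeJong1996

namespace Summit.ResolutionOfSingularities.ResolutionOfSingularities.Theorems.Pialt.IndeterminacySplit

universe u

section Graph

variable {X S C : Scheme.{u}} (f : X ⟶ S) (p : C ⟶ S) (U : S.Opens)
  (β : ((p ⁻¹ᵁ U : C.Opens) : Scheme.{u}) ⟶ (f ⁻¹ᵁ U : X.Opens))
  (hβ : β ≫ (f ⁻¹ᵁ U).ι ≫ f = (p ⁻¹ᵁ U).ι ≫ p)

/-- **Over `𝒞_U` the second projection of the graph closure is `β`** (de Jong 1996, 4.18–4.19: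
`T` is the closure of `Γ_β ≅ 𝒞_U`, and `pr₁ : T → 𝒞` is an isomorphism over `𝒞_U`). With
`pr₁ = graphClosureFst`, `pr₂ = graphClosureSnd`: `(pr₁⁻¹(𝒞_U) ↪ T) ≫ pr₂ = pr₁|_{𝒞_U} ≫ β ≫ ι`.
Indeed the corestriction `t : 𝒞_U → pr₁⁻¹(𝒞_U)` of `𝒞_U → T` is a section of the isomorphism
`pr₁|_{𝒞_U}` (`isIso_graphClosureFst_morphismRestrict`), hence its inverse, and
`t ≫ ι ≫ pr₂ = (𝒞_U → T) ≫ pr₂ = β ≫ ι` (`toGraphClosure_snd`). [cite: DeJong1996, 4.18–4.19] -/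
theorem ι_comp_graphClosureSnd [IsSeparated f] [QuasiCompact (graphMorphism f p U β hβ)]
    [IsReduced ((p ⁻¹ᵁ U : C.Opens) : Scheme.{u})] :
    (graphClosureFst f p U β hβ ⁻¹ᵁ (p ⁻¹ᵁ U)).ι ≫ graphClosureSnd f p U β hβ =
      (graphClosureFst f p U β hβ ∣_ (p ⁻¹ᵁ U)) ≫ β ≫ (f ⁻¹ᵁ U).ι := by
  -- the corestriction `t : 𝒞_U → pr₁⁻¹(𝒞_U)` of `𝒞_U → T`
  have hrange : Set.range (toGraphClosure f p U β hβ) ⊆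
      Set.range (graphClosureFst f p U β hβ ⁻¹ᵁ (p ⁻¹ᵁ U)).ι := by
    rw [Scheme.Opens.range_ι]
    rintro _ ⟨x, rfl⟩
    show graphClosureFst f p U β hβ (toGraphClosure f p U β hβ x) ∈ p ⁻¹ᵁ U
    rw [← Scheme.Hom.comp_apply, toGraphClosure_fst, Scheme.Opens.ι_apply]
    exact x.2
  obtain ⟨t, ht⟩ : ∃ t : ((p ⁻¹ᵁ U : C.Opens) : Scheme.{u}) ⟶
      (graphClosureFst f p U β hβ ⁻¹ᵁ (p ⁻¹ᵁ U) : (graphClosure f p U β hβ).Opens),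
      t ≫ (graphClosureFst f p U β hβ ⁻¹ᵁ (p ⁻¹ᵁ U)).ι = toGraphClosure f p U β hβ :=
    ⟨_, IsOpenImmersion.lift_fac _ _ hrange⟩
  -- `t` is a section of the isomorphism `pr₁ ∣_ 𝒞_U`, hence its inverse
  have hsec : t ≫ (graphClosureFst f p U β hβ ∣_ (p ⁻¹ᵁ U)) = 𝟙 _ := by
    rw [← cancel_mono (p ⁻¹ᵁ U).ι, Category.assoc, morphismRestrict_ι, reassoc_of% ht,
      toGraphClosure_fst, Category.id_comp]
  haveI := (isIso_graphClosureFst_morphismRestrict f p U β hβ).1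
  have hinv : (graphClosureFst f p U β hβ ∣_ (p ⁻¹ᵁ U)) ≫ t = 𝟙 _ := by
    rw [← IsIso.inv_eq_of_inv_hom_id hsec, IsIso.hom_inv_id]
  calc (graphClosureFst f p U β hβ ⁻¹ᵁ (p ⁻¹ᵁ U)).ι ≫ graphClosureSnd f p U β hβ
      = ((graphClosureFst f p U β hβ ∣_ (p ⁻¹ᵁ U)) ≫ t) ≫
          (graphClosureFst f p U β hβ ⁻¹ᵁ (p ⁻¹ᵁ U)).ι ≫ graphClosureSnd f p U β hβ := by
        rw [hinv, Category.id_comp]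
    _ = (graphClosureFst f p U β hβ ∣_ (p ⁻¹ᵁ U)) ≫ β ≫ (f ⁻¹ᵁ U).ι := by
        rw [Category.assoc, reassoc_of% ht, toGraphClosure_snd]

end Graph

/-- **The closure of a graph over the same base** (de Jong 1996, 4.18–4.19 with `𝒞 = S = Y`,
`p = 𝟙 Y`). Let `q : P → Y` be proper, `Y` integral and locally Noetherian, `V ⊆ Y` a non-empty
open and `β : V → q⁻¹(V)` a section of `q` over `V`. Then the closure `T` of the graph of `β` in
`P` (`DeJong1996.graphClosure q (𝟙 Y) V β`) comes with `pr₁ : T → Y` proper and birational,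
`pr₂ : T → P` over `Y` (`pr₂ ≫ q = pr₁`), `T` is integral, and over `V` the second projection is
`β`: `(pr₁⁻¹V ↪ T) ≫ pr₂ = pr₁|_V ≫ β ≫ ι`. [cite: DeJong1996, 4.18–4.19] -/
theorem exists_graphClosure_over_self {P Y : Scheme.{u}} (q : P ⟶ Y) [IsProper q]
    [IsIntegral Y] [IsLocallyNoetherian Y] (V : Y.Opens) (hV : (V : Set Y).Nonempty)
    (β : (V : Scheme.{u}) ⟶ (q ⁻¹ᵁ V : P.Opens)) (hβ : β ≫ (q ⁻¹ᵁ V).ι ≫ q = V.ι) :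
    ∃ (T : Scheme.{u}) (pr₁ : T ⟶ Y) (pr₂ : T ⟶ P), IsIntegral T ∧ IsProper pr₁ ∧
      IsBirational pr₁ ∧ pr₂ ≫ q = pr₁ ∧
        (pr₁ ⁻¹ᵁ V).ι ≫ pr₂ = (pr₁ ∣_ V) ≫ β ≫ (q ⁻¹ᵁ V).ι := by
  -- `β` as a `Y`-morphism on `(𝟙 Y)⁻¹ᵁ V = V`
  have hβ' : β ≫ (q ⁻¹ᵁ V).ι ≫ q = ((𝟙 Y) ⁻¹ᵁ V).ι ≫ 𝟙 Y := by
    rw [Category.comp_id]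
    exact hβ
  -- `V` is integral, and `Γ_β` is quasi-compact (`Y` is locally Noetherian)
  haveI : Nonempty (((𝟙 Y) ⁻¹ᵁ V : Y.Opens) : Scheme.{u}) := by
    obtain ⟨y, hy⟩ := hV
    exact ⟨⟨y, hy⟩⟩
  haveI : IsIntegral (((𝟙 Y) ⁻¹ᵁ V : Y.Opens) : Scheme.{u}) :=
    isIntegral_of_isOpenImmersion ((𝟙 Y) ⁻¹ᵁ V).ι
  haveI : QuasiCompact (graphMorphism q (𝟙 Y) V β hβ') := inferInstance
  refine ⟨graphClosure q (𝟙 Y) V β hβ', graphClosureFst q (𝟙 Y) V β hβ',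
    graphClosureSnd q (𝟙 Y) V β hβ', isIntegral_graphClosure q (𝟙 Y) V β hβ', inferInstance,
    isBirational_graphClosureFst q (𝟙 Y) V β hβ' hV, ?_, ?_⟩
  · rw [graphClosureSnd_comp, Category.comp_id]
  · exact ι_comp_graphClosureSnd q (𝟙 Y) V β hβ'

/-- **Card B, `Pialt ⇒ FrobIndet`** (stub `stub_frobIndet_of_pialtOver` of the line
`SketchIdeator2` / Card B `indeterminacy-split`): the crux conclusion for all integral
separated `k`-schemes of finite type implies purely inseparable elimination of indeterminacy
over `k`. Given `Y`, `X₁` proper integral over `k`, a non-empty open `V ⊆ Y` and a `k`-morphism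
`φ : V → X₁`, let `T` be the closure of the graph of `φ` in `Y ×_k X₁`
(`exists_graphClosure_over_self` for `pr_Y : Y ×_k X₁ → Y` and the corestriction of
`(ι, φ) : V → Y ×_k X₁`): `T` is integral and proper (hence separated, of finite type) over
`k`, `pr₁ : T → Y` is proper birational and `pr₂` restricts to the graph over `V`. The
hypothesis applied to `T` gives `g'' : Y'' → T`; then `g = g'' ≫ pr₁` is a composition of
purely inseparable alterations (proper, surjective, finite radicial over a dense open of `Y`),
`ψ = g'' ≫ pr₂ ≫ pr_{X₁}` is a `k`-morphism, and `ψ = φ ∘ g` on `g⁻¹(V)`. The regularity of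
`Y` is not used. [cite: DeJong1996, 4.18–4.19] -/
theorem stub_frobIndet_of_pialtOver (k : Type) [Field k]
    (hP : ∀ (X' : Scheme.{0}) (f' : X' ⟶ Spec (.of k)), IsSeparated f' → LocallyOfFiniteType f' →
      QuasiCompact f' → IsIntegral X' →
      ∃ (X'' : Scheme.{0}) (g : X'' ⟶ X'), IsProper g ∧ IsIntegral X'' ∧ Scheme.IsRegular X'' ∧
        Function.Surjective g.base ∧ ∃ U : X'.Opens, Dense (U : Set X') ∧ IsFinite (g ∣_ U) ∧
          UniversallyInjective (g ∣_ U))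
    (Y X₁ : Scheme.{0}) (fY : Y ⟶ Spec (.of k)) (f₁ : X₁ ⟶ Spec (.of k))
    [IsProper fY] [IsProper f₁] [IsIntegral Y] (hY : Scheme.IsRegular Y) [IsIntegral X₁]
    (V : Y.Opens) (φ : (V : Scheme.{0}) ⟶ X₁) (hV : (V : Set Y).Nonempty)
    (hφ : V.ι ≫ fY = φ ≫ f₁) :
    ∃ (Y' : Scheme.{0}) (g : Y' ⟶ Y) (ψ : Y' ⟶ X₁), IsProper g ∧ IsIntegral Y' ∧
      Scheme.IsRegular Y' ∧ Function.Surjective g.base ∧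
      (∃ V' : Y.Opens, Dense (V' : Set Y) ∧ IsFinite (g ∣_ V') ∧
        UniversallyInjective (g ∣_ V')) ∧
      ψ ≫ f₁ = g ≫ fY ∧ (g ⁻¹ᵁ V).ι ≫ ψ = (g ∣_ V) ≫ φ := by
  have _ := hY
  -- `Y` is locally Noetherian (of finite type over a field)
  haveI : IsLocallyNoetherian Y := LocallyOfFiniteType.isLocallyNoetherian fY
  -- the graph `(ι, φ) : V → Y ×_k X₁` lands in `pr_Y⁻¹(V)`; `β` is its corestriction
  have hrange : Set.range (pullback.lift V.ι φ hφ : (V : Scheme.{0}) ⟶ pullback fY f₁) ⊆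
      Set.range (pullback.fst fY f₁ ⁻¹ᵁ V).ι := by
    rw [Scheme.Opens.range_ι]
    rintro _ ⟨x, rfl⟩
    show pullback.fst fY f₁ (pullback.lift V.ι φ hφ x) ∈ V
    rw [← Scheme.Hom.comp_apply, pullback.lift_fst, Scheme.Opens.ι_apply]
    exact x.2
  obtain ⟨β, hβ⟩ : ∃ β : (V : Scheme.{0}) ⟶ (pullback.fst fY f₁ ⁻¹ᵁ V : (pullback fY f₁).Opens),
      β ≫ (pullback.fst fY f₁ ⁻¹ᵁ V).ι = pullback.lift V.ι φ hφ :=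
    ⟨_, IsOpenImmersion.lift_fac _ _ hrange⟩
  have hβq : β ≫ (pullback.fst fY f₁ ⁻¹ᵁ V).ι ≫ pullback.fst fY f₁ = V.ι := by
    rw [← Category.assoc, hβ, pullback.lift_fst]
  -- the closure `T` of the graph, `pr₁ : T → Y`, `pr₂ : T → Y ×_k X₁`
  obtain ⟨T, pr₁, pr₂, hT, hpr₁, hbir, hcomm, hkey⟩ :=
    exists_graphClosure_over_self (pullback.fst fY f₁) V hV β hβq
  rw [hβ] at hkey
  haveI := hT
  haveI := hpr₁
  -- apply the crux to the integral separated finite type `k`-scheme `T`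
  obtain ⟨Y', g', hg', hY', hreg, hsurj, W, hW, hWfin, hWui⟩ :=
    hP T (pr₁ ≫ fY) inferInstance inferInstance inferInstance hT
  haveI := hg'
  haveI : Surjective g' := ⟨hsurj⟩
  -- `g' ≫ pr₁` is a composition of purely inseparable alterations
  have hpi : IsPurelyInseparableAlteration (g' ≫ pr₁) :=
    IsPurelyInseparableAlteration.comp ⟨hY', hg', inferInstance, W, hW.nonempty, hWfin, hWui⟩
      hbir.isPurelyInseparableAlteration
  refine ⟨Y', g' ≫ pr₁, g' ≫ pr₂ ≫ pullback.snd fY f₁, inferInstance, hY', hreg,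
    hpi.surjective.1, hpi.exists_dense, ?_, ?_⟩
  · -- `ψ` is a `k`-morphism
    simp only [Category.assoc]
    rw [← pullback.condition, reassoc_of% hcomm]
  · -- compatibility with `φ` on `g⁻¹(V) = g'⁻¹(pr₁⁻¹ V)`
    change (g' ⁻¹ᵁ (pr₁ ⁻¹ᵁ V)).ι ≫ g' ≫ pr₂ ≫ pullback.snd fY f₁ = ((g' ≫ pr₁) ∣_ V) ≫ φ
    rw [← morphismRestrict_ι_assoc, reassoc_of% hkey, pullback.lift_snd, morphismRestrict_comp]
    exact (Category.assoc _ _ _).symm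

end Summit.ResolutionOfSingularities.ResolutionOfSingularities.Theorems.Pialt.IndeterminacySplit

end
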